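import Summits.QuantumFields.QCD.Theorems.SpectralDefectExtinctionWegnerEstimateStubResolventLocalSpectralSum
import Summits.QuantumFields.QCD.Theorems.SpectralDefectExtinctionExtinctionBuildsQCDStubFermiProjectorScreeningMassPin
import Literature.Barriers.QuantumFields.WilsonDeterminantSign
import Literature.MathematicalPhysics.QuantumFieldTheory.QCDPhaseQuenchedPositivity
import Literature.MathematicalPhysics.QuantumFieldTheory.QCDAsymptoticScalingCouplingDivergence
import Literature.MathematicalPhysics.QuantumLattice.OverlapKernelTools

/-!
# Stub A `stub_conditionalSmallBall` of line `determinant-tilt` (crux `SpectralDefectExtinction.ExtinctionBuildsQCD`,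
# item stmt-QuantumFields-18064): the conditional small-ball input at energy 0, TRANSPORTED from T and W

Given the tested tilted cell average T (landed `stub_tiltedCellAverage`, hypothesis 1) and the local Haar–Wegner lemma W
(`stub_localHaarWegnerWide`, Hölder form, masses in `[−1,1]`, hypothesis 2 — crux WegnerEstimate's open bet), the DLR-tested small-ball
bound `⟨F·1{box (x₀,r) bad at level τ}⟩₊ ≤ C (Z_k/a_k)^p (τ/w_f(k))^α ⟨F⟩₊` follows by bookkeeping (§1 private helpers, cf. the public documented lemmas
of the sibling helper module `…StubConditionalSmallBallAux`: (Q) quasi-mode ⇒ localised resolvent trace, taxi geometry, eventual constants;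
§2 the registered stub).  References (prose): Wegner, Z. Phys. B 44 (1981) 9; Montvay–Münster §3.3.3, §5.1; Bhatia, Matrix Analysis III.
-/

noncomputable section

namespace Summit.QuantumFields.QCD.Cruxes.ExtinctionBuildsQCD.DeterminantTilt

open scoped BigOperators Topology Classical MeasureTheory Matrix ENNReal
open Filter MeasureTheory Matrix
open Literature.MathematicalPhysics.QuantumLattice Literature.MathematicalPhysics.QuantumFieldTheory
  Literature.Probability.LatticeModels Literature.MathematicalPhysics.AQFT
open Summit.QuantumFields.QCD.Theses.SpectralDefectExtinction
open Literature.Barriers.QuantumFields.WilsonDeterminant (hermitianWilsonDirac Idx)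

/-! ## §1 Private helpers (cf. the public documented lemmas of the sibling helper module `…StubConditionalSmallBallAux`) -/

/-- an isometry preserves the `ℓ²` sum (adapted from `WegnerEstimateNegative.sum_norm_sq_mulVec_of_isometry`) -/
private theorem sum_norm_sq_mulVec_of_isometryA {n : Type} [Fintype n] [DecidableEq n] {A : Matrix n n ℂ}
    (hA : Aᴴ * A = 1) (w : n → ℂ) :
    ∑ i, ‖(A *ᵥ w) i‖ ^ 2 = ∑ i, ‖w i‖ ^ 2 := by
  have h : ∀ v : n → ℂ, (star v ⬝ᵥ v).re = ∑ i, ‖v i‖ ^ 2 := fun v => by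
    rw [dotProduct, Complex.re_sum]
    refine Finset.sum_congr rfl fun i _ => ?_
    rw [Pi.star_apply, Complex.star_def, Complex.conj_mul', ← Complex.ofReal_pow, Complex.ofReal_re]
  rw [← h, ← h, star_mulVec, ← dotProduct_mulVec, mulVec_mulVec, hA, one_mulVec]

/-- (Q): a non-zero `φ` supported in `P` with `‖Aφ‖² < τ²‖φ‖²` forces `1 ≤ (16τ/3) Σ_{p ∈ P} Im((A − 2τ·i)⁻¹)_{pp}` (Parseval:
the window `|λ| < 2τ` carries `> 3/4` of `‖φ‖²`; Cauchy–Schwarz on the support; `stub_resolventLocalSpectralSum`) -/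
private theorem quasimode_resolvent_traceA {n : Type} [Fintype n] [DecidableEq n] (A : Matrix n n ℂ) (hA : A.IsHermitian)
    (P : Finset n) {τ : ℝ} (hτ : 0 < τ) (φ : n → ℂ) (hφ0 : φ ≠ 0) (hφP : ∀ p ∉ P, φ p = 0)
    (hφ : ∑ p, ‖(A *ᵥ φ) p‖ ^ 2 < τ ^ 2 * ∑ p, ‖φ p‖ ^ 2) :
    1 ≤ 16 * τ / 3 * ∑ p ∈ P, ((A - (((2 * τ : ℝ) : ℂ) * Complex.I) • (1 : Matrix n n ℂ))⁻¹ p p).im := by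
  rw [Cruxes.WegnerEstimate.ResolventCell.stub_resolventLocalSpectralSum n A hA P (2 * τ) (by positivity)]
  set V : Matrix n n ℂ := (hA.eigenvectorUnitary : Matrix n n ℂ) with hVdef
  set lam : n → ℝ := hA.eigenvalues
  set mj : n → ℝ := fun j => ∑ p ∈ P, ‖(hA.eigenvectorBasis j) p‖ ^ 2 with hmj
  set w : n → ℂ := star V *ᵥ φ with hw
  set N : ℝ := ∑ p, ‖φ p‖ ^ 2 with hN
  have hV1 : star V * V = 1 := Unitary.star_mul_self_of_mem (hA.eigenvectorUnitary).2
  have hV2 : V * star V = 1 := Unitary.mul_star_self_of_mem (hA.eigenvectorUnitary).2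
  have hN0 : 0 < N := by
    obtain ⟨p, hp⟩ : ∃ p, φ p ≠ 0 := by by_contra h; push Not at h; exact hφ0 (funext h)
    exact lt_of_lt_of_le (by positivity : 0 < ‖φ p‖ ^ 2)
      (Finset.single_le_sum (f := fun p => ‖φ p‖ ^ 2) (fun _ _ => by positivity) (Finset.mem_univ p))
  -- Parseval `Σ_j ‖w j‖² = N` and `‖Aφ‖² = Σ_j λ_j² ‖w j‖²`
  have hwN : ∑ j, ‖w j‖ ^ 2 = N := by
    rw [hw, sum_norm_sq_mulVec_of_isometryA (by simpa [Matrix.star_eq_conjTranspose] using hV2)]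
  have hAφ : ∑ p, ‖(A *ᵥ φ) p‖ ^ 2 = ∑ j, lam j ^ 2 * ‖w j‖ ^ 2 := by
    have hspec : A = V * diagonal (RCLike.ofReal ∘ hA.eigenvalues) * star V := hA.spectral_theorem
    have h1 : A *ᵥ φ = V *ᵥ (diagonal (RCLike.ofReal ∘ hA.eigenvalues) *ᵥ w) := by
      rw [hw, mulVec_mulVec, mulVec_mulVec, ← hspec]
    rw [h1, sum_norm_sq_mulVec_of_isometryA (by simpa [Matrix.star_eq_conjTranspose] using hV1)]
    refine Finset.sum_congr rfl fun j _ => ?_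
    rw [mulVec_diagonal, norm_mul, mul_pow]
    simp [lam]
  -- Cauchy–Schwarz on the support: `‖w j‖² ≤ m_j N`
  have hmj0 : ∀ j, 0 ≤ mj j := fun j => Finset.sum_nonneg fun _ _ => by positivity
  have hCS : ∀ j, ‖w j‖ ^ 2 ≤ mj j * N := by
    intro j
    have hwj : w j = ∑ p ∈ P, star (V p j) * φ p := by
      rw [hw, mulVec, dotProduct, ← Finset.sum_subset (Finset.subset_univ P)]
      · exact Finset.sum_congr rfl fun p _ => by rw [star_apply]
      · exact fun p _ hp => by rw [hφP p hp, mul_zero]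
    have h1 : ‖w j‖ ≤ ∑ p ∈ P, ‖V p j‖ * ‖φ p‖ :=
      hwj ▸ (norm_sum_le _ _).trans (le_of_eq (Finset.sum_congr rfl fun p _ => by rw [norm_mul, norm_star]))
    calc ‖w j‖ ^ 2 ≤ (∑ p ∈ P, ‖V p j‖ * ‖φ p‖) ^ 2 := pow_le_pow_left₀ (norm_nonneg _) h1 2
      _ ≤ (∑ p ∈ P, ‖V p j‖ ^ 2) * ∑ p ∈ P, ‖φ p‖ ^ 2 := Finset.sum_mul_sq_le_sq_mul_sq P _ _
      _ ≤ mj j * N := by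
          rw [show ∑ p ∈ P, ‖V p j‖ ^ 2 = mj j by simp only [hmj, hVdef, Matrix.IsHermitian.eigenvectorUnitary_apply]]
          exact mul_le_mul_of_nonneg_left (Finset.sum_le_sum_of_subset_of_nonneg (Finset.subset_univ P)
            fun _ _ _ => by positivity) (hmj0 j)
  -- the window `|λ_j| < 2τ` carries more than `3/4` of the mass
  set win : Finset n := Finset.univ.filter (fun j => |lam j| < 2 * τ) with hwin
  have hoff : 4 * τ ^ 2 * ∑ j ∈ Finset.univ.filter (fun j => ¬ |lam j| < 2 * τ), ‖w j‖ ^ 2 ≤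
      ∑ p, ‖(A *ᵥ φ) p‖ ^ 2 := by
    rw [Finset.sum_filter, Finset.mul_sum, hAφ]
    refine Finset.sum_le_sum fun j _ => ?_
    split_ifs with hj
    · rw [mul_zero]; positivity
    · have hj' : 2 * τ ≤ |lam j| := not_lt.1 hj
      nlinarith [sq_nonneg ‖w j‖, sq_abs (lam j), mul_le_mul hj' hj' (by positivity) (abs_nonneg _)]
  have hmwin : 3 / 4 < ∑ j ∈ win, mj j := by
    have h0 := Finset.sum_filter_add_sum_filter_not Finset.univ (fun j => |lam j| < 2 * τ) (fun j => ‖w j‖ ^ 2)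
    rw [hwN] at h0
    have h1 : ∑ j ∈ win, ‖w j‖ ^ 2 ≤ (∑ j ∈ win, mj j) * N := by rw [Finset.sum_mul]; exact Finset.sum_le_sum fun j _ => hCS j
    refine lt_of_mul_lt_mul_right (lt_of_lt_of_le ?_ h1) hN0.le
    rw [hwin]
    nlinarith [mul_pos hN0 (pow_pos hτ 2)]
  -- the spectral sum on the window
  have hlow : 1 / (4 * τ) * ∑ j ∈ win, mj j ≤ ∑ j, mj j * (2 * τ / (lam j ^ 2 + (2 * τ) ^ 2)) := by
    rw [Finset.mul_sum]
    refine le_trans (Finset.sum_le_sum fun j hj => ?_) (Finset.sum_le_sum_of_subset_of_nonneg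
      (Finset.filter_subset _ _) fun j _ _ => mul_nonneg (hmj0 j) (by positivity))
    rw [mul_comm]
    refine mul_le_mul_of_nonneg_left ?_ (hmj0 j)
    have hj' : |lam j| < 2 * τ := (Finset.mem_filter.1 hj).2
    rw [div_le_div_iff₀ (by positivity) (by positivity)]
    nlinarith [sq_abs (lam j), abs_nonneg (lam j)]
  calc (1 : ℝ) = 16 * τ / 3 * (1 / (4 * τ) * (3 / 4)) := by field_simp; norm_num
    _ ≤ 16 * τ / 3 * (1 / (4 * τ) * ∑ j ∈ win, mj j) := by gcongr
    _ ≤ _ := mul_le_mul_of_nonneg_left hlow (by positivity)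

/-- an edge based in the cell `x + box 4 R` (taxi radius `≤ 4R`) with `|x − x₀|₁ ≤ r` is within `r + 4R` of `x₀` -/
private theorem not_far_of_mem_cellA {L : ℕ} [NeZero L] {R r : ℕ} {x x₀ : TorusSite 4 L} (hx : torusTaxiDist x x₀ ≤ r)
    {e : TorusSite 4 L × Fin 4} (he : ∃ y ∈ box 4 R, e.1 = x + Torus.proj L y) : ¬ r + 4 * R < torusTaxiDist e.1 x₀ := by
  obtain ⟨y, hy, hye⟩ := he
  rw [mem_box] at hy
  have h1 : torusTaxiDist e.1 x ≤ 4 * R := by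
    rw [hye]; unfold torusTaxiDist
    refine (Finset.sum_le_sum (g := fun _ => R) fun i _ => ?_).trans (by simp)
    have h1 : (x + Torus.proj L y) i - x i = ((y i : ℤ) : ZMod L) := by simp [Torus.proj_apply]
    rw [h1, ← ZMod.valMinAbs_natAbs_eq_min]
    have := hy i
    have := ZMod.natAbs_min_of_le_div_two L _ (y i) (by rw [ZMod.coe_valMinAbs]) (ZMod.natAbs_valMinAbs_le _)
    omega
  have h2 := torusTaxiDist_triangle e.1 x x₀
  omega

/-- taxi balls are small uniformly in the torus size: covered by the cube `x₀ + box 4 r` via minimal representatives -/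
private theorem card_taxiBall_leA {L : ℕ} [NeZero L] (x₀ : TorusSite 4 L) (r : ℕ) :
    (Finset.univ.filter (fun x : TorusSite 4 L => torusTaxiDist x x₀ ≤ r)).card ≤ (2 * r + 1) ^ 4 := by
  have hsub : Finset.univ.filter (fun x : TorusSite 4 L => torusTaxiDist x x₀ ≤ r) ⊆
      (box 4 r).image (fun y => x₀ + Torus.proj L y) := by
    intro x hx
    have hxr : torusTaxiDist x x₀ ≤ r := (Finset.mem_filter.1 hx).2
    refine Finset.mem_image.2 ⟨fun i => (x i - x₀ i).valMinAbs, ?_, funext fun i => by simp [ZMod.coe_valMinAbs]⟩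
    rw [mem_box]
    intro i
    have h1 : ((x i - x₀ i).valMinAbs).natAbs ≤ r := by
      rw [ZMod.valMinAbs_natAbs_eq_min]
      exact le_trans (Finset.single_le_sum (f := fun j => min (x j - x₀ j).val (L - (x j - x₀ j).val))
        (fun _ _ => Nat.zero_le _) (Finset.mem_univ i)) hxr
    omega
  exact (Finset.card_le_card hsub).trans (Finset.card_image_le.trans (card_box 4 r).le)

/-- Hölder bookkeeping of the level: `τ (2τ)^{−θ} ≤ (τ/w)^{1−θ}` -/
private theorem level_rpow_leA {τ w θ : ℝ} (hτ : 0 < τ) (hw0 : 0 < w) (hw1 : w ≤ 1) (hθ : 0 ≤ θ) (hθ1 : θ ≤ 1) :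
    τ * (2 * τ) ^ (-θ) ≤ (τ / w) ^ (1 - θ) := by
  have h2 : (2 : ℝ) ^ (-θ) ≤ 1 := Real.rpow_le_one_of_one_le_of_nonpos (by norm_num) (by linarith)
  have hw : w ^ (1 - θ) ≤ 1 := Real.rpow_le_one hw0.le hw1 (by linarith)
  calc τ * (2 * τ) ^ (-θ) = τ * ((2 : ℝ) ^ (-θ) * τ ^ (-θ)) := by rw [Real.mul_rpow (by norm_num) hτ.le]
    _ ≤ τ * (1 * τ ^ (-θ)) := by gcongr
    _ = τ ^ (1 - θ) := by rw [one_mul, sub_eq_add_neg, Real.rpow_add hτ, Real.rpow_one]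
    _ = (τ / w) ^ (1 - θ) * w ^ (1 - θ) := by rw [← Real.mul_rpow (div_nonneg hτ.le hw0.le) hw0.le, div_mul_cancel₀ _ hw0.ne']
    _ ≤ (τ / w) ^ (1 - θ) * 1 := mul_le_mul_of_nonneg_left hw (Real.rpow_nonneg (div_nonneg hτ.le hw0.le) _)
    _ = (τ / w) ^ (1 - θ) := mul_one _


/-- polynomial currency: under mass scaling (`Z_k ≥ c_Z/2`), asymptotic scaling (`1 ≤ β_k ≤ Kβ a_k⁻²`: `β_k = afBeta + o(1)`,
`afBeta ≤ (2b₀ + 2|b₁/b₀|) X`, `X = 1/(a²Λ²) ≥ 4`) and CAP: eventually `N ≤ L_k`, `1 ≤ β_k`, `(2L_k+1)⁴ (1 + β_k^q) ≤ K (Z_k/a_k)^p` -/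
private theorem eventually_poly_boundA {Nf : ℕ} (hNf : Nf ≤ 16) (reg : QCDRegularisation Nf) (hMS : reg.HasMassScaling)
    (hAS : (reg.scheme 0 0 0).HasAsymptoticScaling)
    (hCAP : ∃ p : ℕ, ∀ᶠ k in atTop, (reg.L k : ℝ) ≤ (reg.a k)⁻¹ ^ p) (N : ℕ) {q : ℝ} (hq : 0 ≤ q) :
    ∃ K p : ℝ, 0 < K ∧ ∀ᶠ k in atTop, N ≤ reg.L k ∧ 1 ≤ reg.β k ∧
      (2 * (reg.L k : ℝ) + 1) ^ 4 * (1 + reg.β k ^ q) ≤ K * ((reg.a k)⁻¹ * reg.Zm k) ^ p := by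
  obtain ⟨p₀, hp₀⟩ := hCAP
  obtain ⟨cZ, hcZ, hZ⟩ := hMS
  have hβ1 : ∀ᶠ k in atTop, 1 ≤ reg.β k :=
    (QCDRegularisation.tendsto_beta_atTop_of_hasAsymptoticScaling hNf reg 0 0 0 hAS).eventually_ge_atTop 1
  obtain ⟨Λ, hΛ, hε⟩ := hAS
  change Tendsto (fun k => reg.β k - afBeta Nf Λ (reg.a k)) atTop (𝓝 0) at hε
  have h16 : (Nf : ℝ) ≤ 16 := by exact_mod_cast hNf
  have hb₀ : 0 < betaCoeff₀ Nf := by unfold betaCoeff₀; exact div_pos (by linarith) (by positivity)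
  have hexp : 0 ≤ massExponent Nf := by unfold massExponent gammaCoeff₀; positivity
  set K₁ : ℝ := 2 * betaCoeff₀ Nf + 2 * |betaCoeff₁ Nf / betaCoeff₀ Nf| with hK₁
  set pr : ℝ := 4 * (p₀ : ℝ) + 2 * q with hpr
  refine ⟨162 * (1 + K₁ / Λ ^ 2) ^ q * (cZ / 2) ^ (-pr), pr, by positivity, ?_⟩
  filter_upwards [hp₀, hβ1, (tendsto_order.1 hε).2 1 one_pos, (tendsto_order.1 hZ).1 (cZ / 2) (by linarith),
    reg.tendsto_a.eventually (eventually_lt_nhds (by positivity : (0:ℝ) < min (1 / 2) (1 / (2 * Λ)))),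
    reg.tendsto_L.eventually_ge_atTop (N : ℝ)] with k hL hb1 hb2 hr hak hNk
  have hapos := reg.a_pos k
  have ha : reg.a k < 1 / 2 := hak.trans_le (min_le_left _ _)
  refine ⟨?_, hb1, ?_⟩
  · exact_mod_cast hNk.trans (by nlinarith [(Nat.cast_nonneg (reg.L k) : (0 : ℝ) ≤ reg.L k)] : reg.a k * reg.L k ≤ reg.L k)
  -- `Z_k ≥ cZ/2`: `log(1/a²) ≥ 1` once `a < 1/2`
  have hz : cZ / 2 ≤ reg.Zm k := by
    have hlog : 1 ≤ Real.log (1 / reg.a k ^ 2) := by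
      have haa : reg.a k * reg.a k < 1 / 2 * (1 / 2) := mul_lt_mul'' ha ha hapos.le hapos.le
      rw [Real.le_log_iff_exp_le (by positivity), le_div_iff₀ (by positivity)]
      nlinarith [Real.exp_one_lt_d9]
    have h1 := (lt_div_iff₀ (lt_of_lt_of_le one_pos (Real.one_le_rpow hlog hexp))).1 hr
    nlinarith [Real.one_le_rpow hlog hexp]
  -- `β_k ≤ (1 + K₁/Λ²) u²`, `u = a_k⁻¹ ≥ 1`
  set u : ℝ := (reg.a k)⁻¹ with hu
  have hu0 : 0 < u := inv_pos.2 hapos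
  have hu1 : 1 ≤ u := (one_le_inv₀ hapos).2 (by linarith)
  set X : ℝ := 1 / (reg.a k ^ 2 * Λ ^ 2) with hXdef
  have hX4 : 4 ≤ X := by
    have haΛ : reg.a k * Λ < 1 / 2 := by have h := (lt_div_iff₀ (by positivity)).1 (hak.trans_le (min_le_right _ _)); linarith
    have h := mul_lt_mul'' haΛ haΛ (by positivity) (by positivity)
    rw [hXdef, le_div_iff₀ (by positivity)]; nlinarith
  have hX0 : 0 < X := by linarith
  have hlogX1 : 1 ≤ Real.log X := by rw [Real.le_log_iff_exp_le hX0]; linarith [Real.exp_one_lt_d9]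
  have hlogX : Real.log X ≤ X := by linarith [Real.log_le_sub_one_of_pos hX0]
  have hll0 : 0 ≤ Real.log (Real.log X) := Real.log_nonneg hlogX1
  have hll : Real.log (Real.log X) ≤ X := by linarith [Real.log_le_sub_one_of_pos (by linarith : 0 < Real.log X)]
  have haf : afBeta Nf Λ (reg.a k) ≤ K₁ * X := by
    change 2 * betaCoeff₀ Nf * Real.log X + 2 * (betaCoeff₁ Nf / betaCoeff₀ Nf) * Real.log (Real.log X) ≤ _
    nlinarith [mul_nonneg (sub_nonneg.2 (le_abs_self (betaCoeff₁ Nf / betaCoeff₀ Nf))) hll0,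
      mul_le_mul_of_nonneg_left hll (abs_nonneg (betaCoeff₁ Nf / betaCoeff₀ Nf)), mul_le_mul_of_nonneg_left hlogX hb₀.le]
  have hβu : reg.β k ≤ (1 + K₁ / Λ ^ 2) * u ^ 2 := by
    have hXa : K₁ * X = K₁ / Λ ^ 2 * u ^ 2 := by rw [hXdef, hu]; field_simp
    nlinarith [mul_le_mul hu1 hu1 zero_le_one hu0.le, (by positivity : 0 ≤ K₁ / Λ ^ 2 * u ^ 2)]
  -- combine
  have h1 : (2 * (reg.L k : ℝ) + 1) ^ 4 ≤ 81 * u ^ (4 * (p₀ : ℝ)) := by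
    have hup : 1 ≤ u ^ p₀ := one_le_pow₀ hu1
    have h3 : 2 * (reg.L k : ℝ) + 1 ≤ 3 * u ^ p₀ := by linarith
    calc (2 * (reg.L k : ℝ) + 1) ^ 4 ≤ (3 * u ^ p₀) ^ 4 := pow_le_pow_left₀ (by positivity) h3 4
      _ = 81 * u ^ (4 * p₀) := by rw [mul_pow, pow_mul']; norm_num
      _ = 81 * u ^ (4 * (p₀ : ℝ)) := by rw [← Real.rpow_natCast u (4 * p₀)]; push_cast; ring_nf
  have h2 : 1 + reg.β k ^ q ≤ 2 * (1 + K₁ / Λ ^ 2) ^ q * u ^ (2 * q) := by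
    have hbq : reg.β k ^ q ≤ ((1 + K₁ / Λ ^ 2) * u ^ 2) ^ q := Real.rpow_le_rpow (by linarith) hβu hq
    have h1q : 1 ≤ reg.β k ^ q := Real.one_le_rpow hb1 hq
    have heq : ((1 + K₁ / Λ ^ 2) * u ^ 2) ^ q = (1 + K₁ / Λ ^ 2) ^ q * u ^ (2 * q) := by
      rw [Real.mul_rpow (by positivity) (by positivity), Real.rpow_mul hu0.le]; norm_num
    linarith
  have h4 : u ^ pr ≤ (cZ / 2) ^ (-pr) * (u * reg.Zm k) ^ pr := by
    have huY : u ≤ u * reg.Zm k / (cZ / 2) := by rw [le_div_iff₀ (by positivity)]; exact mul_le_mul_of_nonneg_left hz hu0.le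
    calc u ^ pr ≤ (u * reg.Zm k / (cZ / 2)) ^ pr := Real.rpow_le_rpow hu0.le huY (by positivity)
      _ = _ := by rw [Real.div_rpow (mul_nonneg hu0.le (reg.Zm_pos k).le) (by positivity), Real.rpow_neg (by positivity),
          div_eq_inv_mul]
  calc (2 * (reg.L k : ℝ) + 1) ^ 4 * (1 + reg.β k ^ q) ≤ (81 * u ^ (4 * (p₀ : ℝ))) * (2 * (1 + K₁ / Λ ^ 2) ^ q * u ^ (2 * q)) :=
        mul_le_mul h1 h2 (by positivity) (by positivity)
    _ = 162 * (1 + K₁ / Λ ^ 2) ^ q * u ^ pr := by rw [hpr, Real.rpow_add hu0]; ring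
    _ ≤ 162 * (1 + K₁ / Λ ^ 2) ^ q * ((cZ / 2) ^ (-pr) * (u * reg.Zm k) ^ pr) := mul_le_mul_of_nonneg_left h4 (by positivity)
    _ = _ := by ring

/-! ## §2 The registered stub -/

/-- **Stub A (`stub_conditionalSmallBall`) — THE CONDITIONAL SMALL-BALL INPUT AT ENERGY 0, transported from the tested tilted cell
average T (`stub_tiltedCellAverage`, hypothesis 1) and the local Haar–Wegner lemma W (`stub_localHaarWegnerWide`, Hölder form, masses
in `[−1,1]`, hypothesis 2); pure bookkeeping.**  `R₀ = 4R` (taxi radius of W's cells), `α = 1 − θ_W`, `C = (16/3) C_T C_W K`: (Q) pointwise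
`F·1_B ≤ (16τ/3) Σ_{x ∈ ball} F·t_x(·; 2τ)` under the probability `qcdLatticeMeasure`; per site T with `g = t_x(·;2τ)` (`stub_localTraceRegular`)
and `M = C_W (2τ)^{−θ_W}` from W (masses `|m_g(k)| ≤ 1`: mass pin `WeylWindow.stub_massPinAbsLeOne`, TIGHT via `qcdPhaseQuenchedExpect_eq_div_prod`;
`w_f(k) ≤ 1/2` as `a_k/Z_k → 0`; `F` blind to the cell by the triangle inequality); `|ball| ≤ (2r+1)⁴`; then `eventually_poly_boundA`. -/
theorem stub_conditionalSmallBall :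
    (∀ (Nf R : ℕ), ∃ C p : ℝ, 0 < C ∧ 0 ≤ p ∧ ∀ β : ℝ, 1 ≤ β → ∀ mq : Fin Nf → ℝ, (∀ g, -2 ≤ mq g ∧ mq g ≤ 2) →
      ∀ (L : ℕ) [NeZero L], max 4 (2 * R + 3) ≤ L →
      ∀ (x : TorusSite 4 L) (g : GaugeConfig 4 L SU3 → ℝ), Continuous g → (∀ U, 0 ≤ g U) → ∀ M : ℝ,
        (∀ U : GaugeConfig 4 L SU3,
          ∫ V, g (fun e => if (∃ y ∈ box 4 R, e.1 = x + Torus.proj L y) then V e else U e)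
            ∂(Measure.pi fun _ : Edge 4 L => haarProbability SU3) ≤ M) →
        ∀ F : GaugeConfig 4 L SU3 → ℝ, Measurable F → (∀ U, 0 ≤ F U ∧ F U ≤ 1) →
          (∀ U V : GaugeConfig 4 L SU3,
            (∀ e : Edge 4 L, ¬ (∃ y ∈ box 4 R, e.1 = x + Torus.proj L y) → U e = V e) → F U = F V) →
          qcdPhaseQuenchedExpect β L mq (fun U => F U * g U) ≤ C * (1 + β ^ p) * M * qcdPhaseQuenchedExpect β L mq F) →
    (∃ R L₀ : ℕ, ∃ C θ : ℝ, 0 < C ∧ 0 ≤ θ ∧ θ < 1 ∧ ∀ (L : ℕ) [NeZero L], L₀ ≤ L →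
      ∀ (x : TorusSite 4 L) (m₀ ε : ℝ), -1 ≤ m₀ → m₀ ≤ 1 → 0 < ε → ε ≤ 1 →
      ∀ U : GaugeConfig 4 L SU3,
        ∫ V, (∑ a : Fin 3, ∑ α : Fin 4,
          (((spinorLift gammaFive * wilsonDirac (fundamentalRep (Fin 3))
              (fun e => if (∃ y ∈ box 4 R, e.1 = x + Torus.proj L y) then V e else U e) m₀ 1 -
            ((ε : ℂ) * Complex.I) • (1 : Matrix (QuarkIdx L) (QuarkIdx L) ℂ))⁻¹ :
              Matrix (QuarkIdx L) (QuarkIdx L) ℂ) (x, a, α) (x, a, α)).im)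
          ∂(Measure.pi fun _ : Edge 4 L => haarProbability SU3) ≤ C * ε ^ (-θ)) →
    ∀ (Nf : ℕ), Nf = 2 ∨ Nf = 3 → ∀ (reg : QCDRegularisation Nf) (M₀ c : ℝ), 0 ≤ M₀ → 0 < c →
      reg.HasMassScaling → (reg.scheme 0 0 0).HasAsymptoticScaling →
      (∃ p : ℕ, ∀ᶠ k in atTop, (reg.L k : ℝ) ≤ (reg.a k)⁻¹ ^ p) → (∀ᶠ k in atTop, -1 < reg.mcrit k) →
      (∀ m : Fin Nf → ℝ, (∀ f, M₀ < m f) →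
        (∀ ε : ℝ, 0 < ε → ∀ᶠ k in atTop, ∀ S : ℕ, reg.L k ≤ S → qcdPhaseQuenchedExpect (reg.β k) (2 * S + 1) (fun f => reg.mcrit k + reg.a k * m f / reg.Zm k) (fun U => ∑ f : Fin Nf, ((Multiset.countP (fun z : ℂ => z.im = 0 ∧ z.re < -(reg.mcrit k + reg.a k * m f / reg.Zm k)) (wilsonDirac (fundamentalRep (Fin 3)) U 0 1).charpoly.roots : ℝ) + (Multiset.countP (fun z : ℂ => |z.re| < c * (reg.a k * m f / reg.Zm k)) (spinorLift gammaFive * wilsonDirac (fundamentalRep (Fin 3)) U (reg.mcrit k + reg.a k * m f / reg.Zm k) 1).charpoly.roots : ℝ))) ≤ ε * ((2 * S + 1 : ℝ) / (2 * reg.L k + 1)) ^ 4) ∧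
        (∃ η : ℝ, 0 < η ∧ ∀ M : ℝ, M₀ < M → ∀ᶠ k in atTop, max 1 (η * (reg.a k * (2 * reg.L k + 1 : ℝ)) ^ 2) ≤ qcdPhaseQuenchedExpect (reg.β k) (2 * reg.L k + 1) (fun f => reg.mcrit k + reg.a k * m f / reg.Zm k) (fun U => |(Multiset.countP (fun z : ℂ => z.re < 0) (spinorLift gammaFive * wilsonDirac (fundamentalRep (Fin 3)) U (reg.mcrit k - reg.a k * M / reg.Zm k) 1).charpoly.roots : ℝ) - 6 * (2 * reg.L k + 1 : ℝ) ^ 4|))) →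
      ∃ R₀ : ℕ, ∃ α : ℝ, 0 < α ∧ α ≤ 1 ∧ ∀ m : Fin Nf → ℝ, (∀ f, M₀ < m f) → ∀ θ : ℝ, 0 < θ → θ < 1 →
        ∃ C p : ℝ, 0 < C ∧ ∀ᶠ k : ℕ in atTop, ∀ S : ℕ, reg.L k ≤ S →
          ∀ (f : Fin Nf) (x₀ : TorusSite 4 (2 * S + 1)) (r : ℕ), r ≤ reg.L k →
          ∀ τ : ℝ, 0 < τ → τ ≤ θ * (c * (reg.a k * m f / reg.Zm k)) →
          ∀ F : GaugeConfig 4 (2 * S + 1) SU3 → ℝ, Measurable F → (∀ U, 0 ≤ F U ∧ F U ≤ 1) →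
            (∀ U V : GaugeConfig 4 (2 * S + 1) SU3,
              (∀ e : TorusSite 4 (2 * S + 1) × Fin 4, r + R₀ < torusTaxiDist e.1 x₀ → U e = V e) → F U = F V) →
            qcdPhaseQuenchedExpect (reg.β k) (2 * S + 1) (fun fl => reg.mcrit k + reg.a k * m fl / reg.Zm k)
                (fun U : GaugeConfig 4 (2 * S + 1) SU3 =>
                  F U * (if (∃ φ : Idx (2 * S + 1) 3 → ℂ, φ ≠ 0 ∧ (∀ p, r < torusTaxiDist p.1 x₀ → φ p = 0) ∧ ∑ p, ‖(hermitianWilsonDirac (fundamentalRep (Fin 3)) U (reg.mcrit k + reg.a k * m f / reg.Zm k) 1 *ᵥ φ) p‖ ^ 2 < τ ^ 2 * ∑ p, ‖φ p‖ ^ 2) then (1 : ℝ) else 0)) ≤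
              C * ((reg.a k)⁻¹ * reg.Zm k) ^ p * (τ / (c * (reg.a k * m f / reg.Zm k))) ^ α *
                qcdPhaseQuenchedExpect (reg.β k) (2 * S + 1) (fun fl => reg.mcrit k + reg.a k * m fl / reg.Zm k) F := by
  intro hT hW Nf hNf reg M₀ c hM₀ hc hMS hAS hCAP hBR hSD
  have hNf16 : Nf ≤ 16 := by rcases hNf with rfl | rfl <;> norm_num
  obtain ⟨R, L₀, C_W, θ_W, hCW, hθ0, hθ1, hW'⟩ := hW
  obtain ⟨C_T, p_T, hCT, hpT, hT'⟩ := hT Nf R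
  obtain ⟨K, p, hK, hpoly⟩ := eventually_poly_boundA hNf16 reg hMS hAS hCAP (max (max 4 (2 * R + 3)) L₀) hpT
  refine ⟨4 * R, 1 - θ_W, by linarith, by linarith, fun m hm θ hθ0' hθ1' => ⟨16 / 3 * C_T * C_W * K, p, by positivity, ?_⟩⟩
  have hmpos : ∀ f, 0 < m f := fun f => hM₀.trans_lt (hm f)
  -- TIGHT (phase-quenched reading) ⇒ `Negative.Tight` ⇒ the mass pin `|m_f(k)| ≤ 1`
  have hTight : Summit.QuantumFields.QCD.Theorems.ExtinctionBuildsQCD.Negative.Tight Nf reg M₀ m := by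
    intro M hM
    obtain ⟨η, -, hη'⟩ := (hSD m hm).2
    filter_upwards [hη' M hM] with k hk
    have h1 := (le_max_left _ _).trans hk; rwa [qcdPhaseQuenchedExpect_eq_div_prod] at h1
  have hpin := WeylWindow.stub_massPinAbsLeOne Nf hNf16 reg M₀ hM₀ hMS hBR m hm hTight
  -- the EXTINCT window `w_f(k) = c a_k m_f/Z_k` shrinks: eventually `w_f(k) ≤ 1/2` for every flavour
  have hw : ∀ᶠ k in atTop, ∀ f, c * (reg.a k * m f / reg.Zm k) ≤ 1 / 2 := by
    refine eventually_all.2 fun f => ?_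
    have hmf := hmpos f
    filter_upwards [WeylWindow.eventually_a_le_mul_Zm hNf16 reg hMS (ε := 1 / (2 * c * m f)) (by positivity)] with k hk
    rw [mul_div_assoc', div_le_iff₀ (reg.Zm_pos k)]
    calc c * (reg.a k * m f) = (c * m f) * reg.a k := by ring
      _ ≤ (c * m f) * (1 / (2 * c * m f) * reg.Zm k) := mul_le_mul_of_nonneg_left hk (by positivity)
      _ = 1 / 2 * reg.Zm k := by field_simp
  filter_upwards [hpoly, hpin, hw] with k hpk hpink hwk
  intro S hS f x₀ r hr τ hτ0 hτw F hFm hF01 hFloc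
  obtain ⟨hLk, hβ1, hpolyk⟩ := hpk
  have hapos := reg.a_pos k
  set w : ℝ := c * (reg.a k * m f / reg.Zm k) with hwdef
  have hw0 : 0 < w := by have := hmpos f; have := reg.Zm_pos k; positivity
  have hw2 : w ≤ 1 / 2 := hwk f
  have hτ1 : 2 * τ ≤ 1 := by nlinarith
  have hε0 : 0 < 2 * τ := by positivity
  have hL1 : max 4 (2 * R + 3) ≤ 2 * S + 1 := by have := (le_max_left _ _).trans hLk; omega
  have hL2 : L₀ ≤ 2 * S + 1 := by have := (le_max_right _ _).trans hLk; omega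
  set m₀ : ℝ := reg.mcrit k + reg.a k * m f / reg.Zm k with hm₀def
  have hm₀ : |m₀| ≤ 1 := hpink f
  set mq : Fin Nf → ℝ := fun fl => reg.mcrit k + reg.a k * m fl / reg.Zm k with hmqdef
  -- the colour–spin resolvent trace `t_x(U; 2τ)` (`g x`), the probability `P` behind `⟨·⟩₊`, the taxi ball
  set g : TorusSite 4 (2 * S + 1) → GaugeConfig 4 (2 * S + 1) SU3 → ℝ := fun x U => ∑ a : Fin 3, ∑ α : Fin 4,
    (((spinorLift gammaFive * wilsonDirac (fundamentalRep (Fin 3)) U m₀ 1 -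
      (((2 * τ : ℝ) : ℂ) * Complex.I) • (1 : Matrix (QuarkIdx (2 * S + 1)) (QuarkIdx (2 * S + 1)) ℂ))⁻¹ :
        Matrix (QuarkIdx (2 * S + 1)) (QuarkIdx (2 * S + 1)) ℂ) (x, a, α) (x, a, α)).im with hg
  have hreg : ∀ x, Continuous (g x) ∧ ∀ U, 0 ≤ g x U ∧ g x U ≤ 12 / (2 * τ) :=
    fun x => Cruxes.WegnerEstimate.ResolventCell.stub_localTraceRegular (2 * S + 1) x m₀ (2 * τ) hε0
  set P : Measure (GaugeConfig 4 (2 * S + 1) SU3) := qcdLatticeMeasure (2 * S + 1) (reg.β k) mq with hP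
  haveI : IsProbabilityMeasure P := isProbabilityMeasure_qcdLatticeMeasure_all (reg.β k) mq
  have hE : ∀ ψ : GaugeConfig 4 (2 * S + 1) SU3 → ℝ, qcdPhaseQuenchedExpect (reg.β k) (2 * S + 1) mq ψ = ∫ U, ψ U ∂P :=
    fun ψ => qcdPhaseQuenchedExpect_eq_integral_qcdLatticeMeasure (reg.β k) mq ψ
  set ball : Finset (TorusSite 4 (2 * S + 1)) := Finset.univ.filter (fun x => torusTaxiDist x x₀ ≤ r) with hball
  have hI : ∀ x, Integrable (fun U => F U * g x U) P := fun x =>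
    Integrable.of_bound ((hFm.mul (hreg x).1.measurable).aestronglyMeasurable) (12 / (2 * τ)) (ae_of_all _ fun U => by
      rw [Real.norm_eq_abs, abs_of_nonneg (mul_nonneg (hF01 U).1 ((hreg x).2 U).1)]
      exact (mul_le_mul (hF01 U).2 ((hreg x).2 U).2 ((hreg x).2 U).1 zero_le_one).trans_eq (one_mul _))
  -- T ∘ W cell by cell: `⟨F t_x⟩₊ ≤ M ⟨F⟩₊`, `M = C_T (1+β^{p_T}) C_W (2τ)^{−θ_W}`, for `x` in the ball
  set E : ℝ := qcdPhaseQuenchedExpect (reg.β k) (2 * S + 1) mq F with hEdef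
  have hF0 : 0 ≤ E := by rw [hEdef, hE]; exact integral_nonneg fun U => (hF01 U).1
  set M : ℝ := C_T * (1 + reg.β k ^ p_T) * (C_W * (2 * τ) ^ (-θ_W)) with hM
  have hM0 : 0 ≤ M := by
    have := Real.rpow_nonneg (by linarith : 0 ≤ reg.β k) p_T; have := Real.rpow_nonneg hε0.le (-θ_W); positivity
  have hTx : ∀ x ∈ ball, qcdPhaseQuenchedExpect (reg.β k) (2 * S + 1) mq (fun U => F U * g x U) ≤ M * E := by
    intro x hx
    have hxr : torusTaxiDist x x₀ ≤ r := (Finset.mem_filter.1 hx).2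
    rw [hM, hEdef]
    refine hT' (reg.β k) hβ1 mq (fun g' => ⟨by linarith [(abs_le.1 (hpink g')).1], by linarith [(abs_le.1 (hpink g')).2]⟩)
      (2 * S + 1) hL1 x (g x) (hreg x).1 (fun U => ((hreg x).2 U).1) _ (fun U => ?_) F hFm hF01 fun U V hUV => ?_
    · exact hW' (2 * S + 1) hL2 x m₀ (2 * τ) (abs_le.1 hm₀).1 (abs_le.1 hm₀).2 hε0 hτ1 U
    · exact hFloc U V fun e he => hUV e fun hcell => not_far_of_mem_cellA hxr hcell he
  -- (Q) pointwise and integration: `⟨F·1_B⟩₊ ≤ (16τ/3) Σ_{x ∈ ball} ⟨F·t_x⟩₊ ≤ (16τ/3) (2r+1)⁴ M ⟨F⟩₊`; then the constants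
  refine le_trans (b := 16 * τ / 3 * ((2 * r + 1 : ℝ) ^ 4 * (M * E))) ?_ ?_
  · rw [hE]
    refine (integral_mono_of_nonneg (ae_of_all _ fun U => mul_nonneg (hF01 U).1 (by split_ifs <;> norm_num))
      ((integrable_finsetSum ball fun x _ => hI x).const_mul (16 * τ / 3)) (ae_of_all _ fun U => ?_)).trans ?_
    · have hsum0 : 0 ≤ ∑ x ∈ ball, F U * g x U := Finset.sum_nonneg fun x _ => mul_nonneg (hF01 U).1 ((hreg x).2 U).1
      change F U * _ ≤ 16 * τ / 3 * ∑ x ∈ ball, F U * g x U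
      split_ifs with hB
      · obtain ⟨φ, hφ0, hφsupp, hφsmall⟩ := hB
        have hφP : ∀ p ∉ ball ×ˢ (Finset.univ : Finset (Fin 3 × Fin 4)), φ p = 0 := fun p hp =>
          hφsupp p (not_le.1 fun h => hp (by simp [hball, h]))
        have hQ := quasimode_resolvent_traceA _ (Literature.Barriers.QuantumFields.isHermitian_gammaFive_mul_wilsonDirac
          (fundamentalRep (Fin 3)) fundamentalRep_mem_unitaryGroup U m₀ 1) _ hτ0 φ hφ0 hφP hφsmall
        rw [Finset.sum_product] at hQ
        calc F U * 1 ≤ F U * (16 * τ / 3 * ∑ x ∈ ball, g x U) :=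
              (mul_one _).trans_le (le_mul_of_one_le_right (hF01 U).1 (hQ.trans_eq (by
                congr 1; exact Finset.sum_congr rfl fun x _ => by rw [Fintype.sum_prod_type])))
          _ = 16 * τ / 3 * ∑ x ∈ ball, F U * g x U := by
              simp only [Finset.mul_sum]; exact Finset.sum_congr rfl fun x _ => by ring
      · rw [mul_zero]; exact mul_nonneg (by positivity) hsum0
    · rw [integral_const_mul, integral_finsetSum ball fun x _ => hI x]
      refine mul_le_mul_of_nonneg_left ?_ (by positivity)
      calc ∑ x ∈ ball, ∫ U, F U * g x U ∂P ≤ ∑ x ∈ ball, M * E :=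
            Finset.sum_le_sum fun x hx => (hE _).symm.trans_le (hTx x hx)
        _ = ball.card * (M * E) := by rw [Finset.sum_const, nsmul_eq_mul]
        _ ≤ (2 * r + 1 : ℝ) ^ 4 * (M * E) :=
            mul_le_mul_of_nonneg_right (by exact_mod_cast card_taxiBall_leA x₀ r) (mul_nonneg hM0 hF0)
  have hrL : (r : ℝ) ≤ reg.L k := by exact_mod_cast hr
  have hX : (2 * r + 1 : ℝ) ^ 4 * (1 + reg.β k ^ p_T) ≤ K * ((reg.a k)⁻¹ * reg.Zm k) ^ p :=
    (mul_le_mul_of_nonneg_right (pow_le_pow_left₀ (by positivity) (by linarith) 4)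
      (by linarith [Real.rpow_nonneg (by linarith : 0 ≤ reg.β k) p_T])).trans hpolyk
  have hZpos := reg.Zm_pos k
  have step : 16 / 3 * C_T * C_W * ((2 * r + 1 : ℝ) ^ 4 * (1 + reg.β k ^ p_T)) * (τ * (2 * τ) ^ (-θ_W)) ≤
      16 / 3 * C_T * C_W * (K * ((reg.a k)⁻¹ * reg.Zm k) ^ p) * (τ / w) ^ (1 - θ_W) :=
    mul_le_mul (mul_le_mul_of_nonneg_left hX (by positivity)) (level_rpow_leA hτ0 hw0 (by linarith) hθ0 hθ1.le)
      (mul_nonneg hτ0.le (Real.rpow_nonneg hε0.le _)) (by positivity)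
  calc 16 * τ / 3 * ((2 * r + 1 : ℝ) ^ 4 * (M * E))
      = 16 / 3 * C_T * C_W * ((2 * r + 1 : ℝ) ^ 4 * (1 + reg.β k ^ p_T)) * (τ * (2 * τ) ^ (-θ_W)) * E := by rw [hM]; ring
    _ ≤ 16 / 3 * C_T * C_W * (K * ((reg.a k)⁻¹ * reg.Zm k) ^ p) * (τ / w) ^ (1 - θ_W) * E := mul_le_mul_of_nonneg_right step hF0
    _ = 16 / 3 * C_T * C_W * K * ((reg.a k)⁻¹ * reg.Zm k) ^ p * (τ / w) ^ (1 - θ_W) * E := by ring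

end Summit.QuantumFields.QCD.Cruxes.ExtinctionBuildsQCD.DeterminantTilt

end
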